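import Summits.QuantumFields.GaugeBoot.ClassBNegativeCouplingShift
import HarnessLib

/-!
# Haar averages of plaquette characters over one link (gauge-boot, Class B; DLR sign rule 1/2)

HONEST FRAMING (cell `pub-gaugeboot`, page 1 of every file): the venture produces certified bounds
on lattice expectations at stated coupling, gauge group, dimension and torus size; NOT a mass gap,
NOT a continuum limit, NOT a string tension; NOT Yang–Mills-summit-bearing (barriers
`FixedCouplingUltralocality`, `PerturbativeInvisibility`). Lemmas for `HaarShiftPlaquetteSign.lean`;
certifies no number.

## Content

`ρ : G → M_N(ℂ)` a representation of the compact group `G` WITHOUT INVARIANT VECTORS in the usable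
form `hρ0 : ∀ m, ∫ Re tr ρ(g m) dg = 0` (every non-trivial irreducible `ρ`; every `ρ` with a central
scalar `ω ≠ 1`, `integral_re_trace_mul_eq_zero_of_smul_one` in part 2).

* `plaquetteHolonomyZd_update_affine` — a plaquette holonomy of `ℤ^d` is `a·h·b` or `a·h⁻¹·b` in
  each of its links `h = U_e` (`a, b` words in the other links);
* `integral_re_trace_twoSided_eq_zero` — `∫ Re tr ρ(a g b) dg = ∫ Re tr ρ(a g⁻¹ b) dg = 0`;
* `integral_haar_plaquetteObs_update_eq_zero` — the Haar average over one link of a plaquette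
  character vanishes;
* ★ `integral_haar_shiftAction` — hence, with `S_e = wilsonBoundaryAction ρ {e}` and
  `Δ_g(U) = S_e(U[e ↦ g⁻¹U_e]) - S_e(U)`: `∫ Δ_g(U) dg = Σ_{p ∋ e} Re tr ρ(U_p)` for every `U`;
* `continuous_shiftAction_uncurry`, `continuous_integral_shiftAction` (dominated convergence),
  ★ `integral_haar_integral_shiftAction` (Fubini): `∫ (∫ Δ_g dμ) dg = Σ_{p ∋ e} ∫ Re tr ρ(U_p) dμ`
  for every finite measure `μ` on configurations.

Elementary; [folklore] bookkeeping.
-/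


open MeasureTheory Complex Finset Function
open scoped ComplexOrder

namespace Summit.QuantumFields.GaugeBoot

open Literature.MathematicalPhysics.QuantumFieldTheory (haarProbability integrable_haar_of_continuous)
open Literature.MathematicalPhysics.QuantumLattice
open Literature.RepresentationTheory.CompactGroups

noncomputable section

variable {d N : ℕ} {G : Type*} [Group G] [TopologicalSpace G] [IsTopologicalGroup G]
  [CompactSpace G] [MeasurableSpace G] [BorelSpace G] (ρ : G →* Matrix (Fin N) (Fin N) ℂ)

/-! ## A plaquette holonomy is affine in each of its links -/

section Affine

omit [TopologicalSpace G] [IsTopologicalGroup G] [CompactSpace G] [MeasurableSpace G] [BorelSpace G] in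
/-- For a plaquette `p` of `ℤ^d` and one of its links `e` there are `a, b` (depending on the other
links of the configuration) with `U_p[e ↦ h] = a h b` for all `h`, or `U_p[e ↦ h] = a h⁻¹ b` for all
`h`. -/
theorem plaquetteHolonomyZd_update_affine (p : ZdPlaquette d) {e : ZdEdge d}
    (he : e ∈ plaquetteEdges p) (U : LGConfig d G) :
    ∃ a b : G, (∀ h : G, plaquetteHolonomyZd (Function.update U e h) p.1 p.2.1.1 p.2.1.2 = a * h * b) ∨
      (∀ h : G, plaquetteHolonomyZd (Function.update U e h) p.1 p.2.1.1 p.2.1.2 = a * h⁻¹ * b) := by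
  classical
  obtain ⟨x, ⟨⟨i, j⟩, hij⟩⟩ := p
  have hne : i ≠ j := ne_of_lt hij
  have hvi : x + Pi.single i (1 : ℤ) ≠ x := by
    intro h; have := congrFun h i; simp at this
  have hvj : x + Pi.single j (1 : ℤ) ≠ x := by
    intro h; have := congrFun h j; simp at this
  have hab : ((x, i) : ZdEdge d) ≠ (x + Pi.single i 1, j) := fun h => hne (congrArg Prod.snd h)
  have hac : ((x, i) : ZdEdge d) ≠ (x + Pi.single j 1, i) := fun h => hvj (congrArg Prod.fst h).symm
  have had : ((x, i) : ZdEdge d) ≠ (x, j) := fun h => hne (congrArg Prod.snd h)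
  have hbc : ((x + Pi.single i 1, j) : ZdEdge d) ≠ (x + Pi.single j 1, i) :=
    fun h => hne (congrArg Prod.snd h).symm
  have hbd : ((x + Pi.single i 1, j) : ZdEdge d) ≠ (x, j) := fun h => hvi (congrArg Prod.fst h)
  have hcd : ((x + Pi.single j 1, i) : ZdEdge d) ≠ (x, j) := fun h => hne (congrArg Prod.snd h)
  simp only [plaquetteEdges, Finset.mem_insert, Finset.mem_singleton] at he
  simp only
  rcases he with rfl | rfl | rfl | rfl
  · refine ⟨1, U (x + Pi.single i 1, j) * (U (x + Pi.single j 1, i))⁻¹ * (U (x, j))⁻¹, Or.inl fun h => ?_⟩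
    simp only [plaquetteHolonomyZd, Function.update_self, Function.update_of_ne hab.symm,
      Function.update_of_ne hac.symm, Function.update_of_ne had.symm, one_mul, mul_assoc]
  · refine ⟨U (x, i), (U (x + Pi.single j 1, i))⁻¹ * (U (x, j))⁻¹, Or.inl fun h => ?_⟩
    simp only [plaquetteHolonomyZd, Function.update_self, Function.update_of_ne hab,
      Function.update_of_ne hbc.symm, Function.update_of_ne hbd.symm, mul_assoc]
  · refine ⟨U (x, i) * U (x + Pi.single i 1, j), (U (x, j))⁻¹, Or.inr fun h => ?_⟩
    simp only [plaquetteHolonomyZd, Function.update_self, Function.update_of_ne hac,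
      Function.update_of_ne hbc, Function.update_of_ne hcd.symm, mul_assoc]
  · refine ⟨U (x, i) * U (x + Pi.single i 1, j) * (U (x + Pi.single j 1, i))⁻¹, 1, Or.inr fun h => ?_⟩
    simp only [plaquetteHolonomyZd, Function.update_self, Function.update_of_ne had,
      Function.update_of_ne hbd, Function.update_of_ne hcd, mul_one]

end Affine

/-! ## Haar averages over one link -/

section Haar

omit [TopologicalSpace G] [IsTopologicalGroup G] [CompactSpace G] [MeasurableSpace G] [BorelSpace G] in
/-- Cyclicity: `Re tr ρ(a g b) = Re tr ρ(g (b a))`. -/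
theorem re_trace_conj_cycle (a g b : G) :
    ((ρ (a * g * b)).trace).re = ((ρ (g * (b * a))).trace).re := by
  rw [mul_assoc, map_mul, Matrix.trace_mul_comm, ← map_mul, mul_assoc]

variable [SecondCountableTopology G]

omit [SecondCountableTopology G] in
/-- From `∫ Re tr ρ(g m) dg = 0` for all `m`: the two-sided averages vanish, `∫ Re tr ρ(a g b) dg = 0`
and `∫ Re tr ρ(a g⁻¹ b) dg = 0`. -/
theorem integral_re_trace_twoSided_eq_zero
    (hρ0 : ∀ m : G, ∫ g, ((ρ (g * m)).trace).re ∂(haarProbability G) = 0) (a b : G) :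
    ∫ g, ((ρ (a * g * b)).trace).re ∂(haarProbability G) = 0 ∧
      ∫ g, ((ρ (a * g⁻¹ * b)).trace).re ∂(haarProbability G) = 0 := by
  have h1 : ∫ g, ((ρ (a * g * b)).trace).re ∂(haarProbability G) = 0 := by
    simp_rw [re_trace_conj_cycle ρ a _ b]
    exact hρ0 (b * a)
  refine ⟨h1, ?_⟩
  have h := integral_inv_eq_self (fun g => ((ρ (a * g * b)).trace).re) (haarProbability G)
  rw [h]
  exact h1

omit [SecondCountableTopology G] in
/-- **The Haar average over one link of a plaquette character vanishes** (`ρ` without invariant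
vectors): `∫ Re tr ρ(U_p[e ↦ g⁻¹ U_e]) dg = 0` for `e` a link of `p`. -/
theorem integral_haar_plaquetteObs_update_eq_zero
    (hρ0 : ∀ m : G, ∫ g, ((ρ (g * m)).trace).re ∂(haarProbability G) = 0) (p : ZdPlaquette d)
    {e : ZdEdge d} (he : e ∈ plaquetteEdges p) (U : LGConfig d G) :
    ∫ g, plaquetteObs ρ p.1 p.2.1.1 p.2.1.2 (Function.update U e (g⁻¹ * U e)) ∂(haarProbability G)
      = 0 := by
  obtain ⟨a, b, h | h⟩ := plaquetteHolonomyZd_update_affine p he U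
  · simp only [plaquetteObs, h]
    have : ∀ g : G, a * (g⁻¹ * U e) * b = a * g⁻¹ * (U e * b) := fun g => by group
    simp_rw [this]
    exact (integral_re_trace_twoSided_eq_zero ρ hρ0 a (U e * b)).2
  · simp only [plaquetteObs, h]
    have : ∀ g : G, a * (g⁻¹ * U e)⁻¹ * b = a * (U e)⁻¹ * g * b := fun g => by group
    simp_rw [this]
    exact (integral_re_trace_twoSided_eq_zero ρ hρ0 (a * (U e)⁻¹) b).1

omit [SecondCountableTopology G] in
/-- ★ **The Haar average over `g` of the one-link shift of the boundary action is the sum of the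
plaquette characters through the link**: `∫ Δ_g(U) dg = Σ_{p ∋ e} Re tr ρ(U_p)`, pointwise in `U`. -/
theorem integral_haar_shiftAction (hρ : Continuous ρ)
    (hρ0 : ∀ m : G, ∫ g, ((ρ (g * m)).trace).re ∂(haarProbability G) = 0) (e : ZdEdge d)
    (U : LGConfig d G) :
    ∫ g, (wilsonBoundaryAction ρ {e} (Function.update U e (g⁻¹ * U e)) - wilsonBoundaryAction ρ {e} U)
        ∂(haarProbability G) =
      ∑ p ∈ plaquettesTouching ({e} : Finset (ZdEdge d)), plaquetteObs ρ p.1 p.2.1.1 p.2.1.2 U := by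
  simp only [wilsonBoundaryAction]
  have hcont : ∀ p : ZdPlaquette d, Continuous fun g : G =>
      plaquetteObs ρ p.1 p.2.1.1 p.2.1.2 (Function.update U e (g⁻¹ * U e)) := fun p =>
    (continuous_plaquetteObs ρ hρ _ _ _).comp
      ((continuous_glueMul_aux e U).comp continuous_inv)
  have hint : ∀ p : ZdPlaquette d, Integrable (fun g : G =>
      (N : ℝ) - plaquetteObs ρ p.1 p.2.1.1 p.2.1.2 (Function.update U e (g⁻¹ * U e)))
      (haarProbability G) := fun p =>
    (integrable_const _).sub (integrable_haar_of_continuous (hcont p))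
  rw [integral_sub (integrable_finsetSum _ fun p _ => hint p) (integrable_const _),
    integral_finsetSum _ fun p _ => hint p, integral_const, probReal_univ, one_smul]
  rw [← Finset.sum_sub_distrib]
  have hterm : ∀ p ∈ plaquettesTouching ({e} : Finset (ZdEdge d)),
      ∫ g, ((N : ℝ) - plaquetteObs ρ p.1 p.2.1.1 p.2.1.2 (Function.update U e (g⁻¹ * U e)))
        ∂(haarProbability G) = N := by
    intro p hp
    have he : e ∈ plaquetteEdges p := by
      obtain ⟨e', he'⟩ := mem_plaquettesTouching_iff.1 hp
      rw [Finset.mem_inter, Finset.mem_singleton] at he'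
      exact he'.2 ▸ he'.1
    rw [integral_sub (integrable_const _) (integrable_haar_of_continuous (hcont p)),
      integral_const, probReal_univ, one_smul, integral_haar_plaquetteObs_update_eq_zero ρ hρ0 p he U,
      sub_zero]
  rw [Finset.sum_congr rfl fun p hp => by rw [hterm p hp]]
  simp
where
  /-- continuity of `g ↦ U[e ↦ g·U_e]` -/
  continuous_glueMul_aux (e : ZdEdge d) (U : LGConfig d G) :
      Continuous fun g : G => Function.update U e (g * U e) := by
    refine continuous_pi fun x => ?_
    by_cases hx : x = e
    · subst hx; simp only [Function.update_self]; exact continuous_id.mul continuous_const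
    · simp only [Function.update_of_ne hx]; exact continuous_const

end Haar

/-! ## Averaging over the state (Fubini) -/

section Fubini

variable [SecondCountableTopology G]

omit [CompactSpace G] [MeasurableSpace G] [BorelSpace G] [SecondCountableTopology G] in
/-- Joint continuity of `(g, U) ↦ Δ_g(U)`. -/
theorem continuous_shiftAction_uncurry (hρ : Continuous ρ) (e : ZdEdge d) :
    Continuous fun q : G × LGConfig d G =>
      wilsonBoundaryAction ρ {e} (Function.update q.2 e (q.1⁻¹ * q.2 e)) -
        wilsonBoundaryAction ρ {e} q.2 := by
  have hupd : Continuous fun q : G × LGConfig d G => Function.update q.2 e (q.1⁻¹ * q.2 e) := by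
    refine continuous_pi fun x => ?_
    by_cases hx : x = e
    · subst hx
      simp only [Function.update_self]
      exact continuous_fst.inv.mul ((continuous_apply x).comp continuous_snd)
    · simp only [Function.update_of_ne hx]
      exact (continuous_apply x).comp continuous_snd
  exact ((continuous_wilsonBoundaryAction ρ hρ {e}).comp hupd).sub
    ((continuous_wilsonBoundaryAction ρ hρ {e}).comp continuous_snd)

/-- `g ↦ ∫ Δ_g dμ` is continuous (dominated convergence with a constant bound). -/
theorem continuous_integral_shiftAction (hρ : Continuous ρ) (μ : Measure (LGConfig d G))
    [IsFiniteMeasure μ] (e : ZdEdge d) :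
    Continuous fun g : G => ∫ U, (wilsonBoundaryAction ρ {e} (Function.update U e (g⁻¹ * U e)) -
      wilsonBoundaryAction ρ {e} U) ∂μ := by
  have hc := continuous_shiftAction_uncurry ρ hρ e
  obtain ⟨C, hC⟩ := isCompact_univ.exists_bound_of_continuousOn hc.continuousOn
  refine continuous_of_dominated
    (F := fun (g : G) (U : LGConfig d G) =>
      wilsonBoundaryAction ρ {e} (Function.update U e (g⁻¹ * U e)) - wilsonBoundaryAction ρ {e} U)
    (bound := fun _ => C) (fun g => ?_) (fun g => ae_of_all _ fun U => ?_)
    (integrable_const C) (ae_of_all _ fun U => ?_)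
  · exact (continuous_shiftAction ρ hρ e g).measurable.aestronglyMeasurable
  · exact hC (g, U) (Set.mem_univ _)
  · have hu : Continuous fun g : G => Function.update U e (g⁻¹ * U e) := by
      refine continuous_pi fun x => ?_
      by_cases hx : x = e
      · subst hx
        simp only [Function.update_self]
        exact continuous_inv.mul continuous_const
      · simp only [Function.update_of_ne hx]
        exact continuous_const
    exact ((continuous_wilsonBoundaryAction ρ hρ {e}).comp hu).sub continuous_const

/-- ★ **Averaging the one-link shift over the group**: `∫ (∫ Δ_g dμ) dg = Σ_{p ∋ e} ∫ Re tr ρ(U_p) dμ`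
(Fubini, then `integral_haar_shiftAction`). -/
theorem integral_haar_integral_shiftAction (hρ : Continuous ρ)
    (hρ0 : ∀ m : G, ∫ g, ((ρ (g * m)).trace).re ∂(haarProbability G) = 0)
    (μ : Measure (LGConfig d G)) [IsFiniteMeasure μ] (e : ZdEdge d) :
    ∫ g, (∫ U, (wilsonBoundaryAction ρ {e} (Function.update U e (g⁻¹ * U e)) -
      wilsonBoundaryAction ρ {e} U) ∂μ) ∂(haarProbability G) =
      ∑ p ∈ plaquettesTouching ({e} : Finset (ZdEdge d)),
        ∫ U, plaquetteObs ρ p.1 p.2.1.1 p.2.1.2 U ∂μ := by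
  have hc := continuous_shiftAction_uncurry ρ hρ e
  obtain ⟨C, hC⟩ := isCompact_univ.exists_bound_of_continuousOn hc.continuousOn
  have hint : Integrable (uncurry fun (g : G) (U : LGConfig d G) =>
      wilsonBoundaryAction ρ {e} (Function.update U e (g⁻¹ * U e)) - wilsonBoundaryAction ρ {e} U)
      ((haarProbability G).prod μ) :=
    Integrable.of_bound hc.aestronglyMeasurable C (ae_of_all _ fun q => hC q (Set.mem_univ _))
  rw [integral_integral_swap hint]
  rw [← integral_finsetSum _ fun p _ =>
    integrable_of_continuous_real (continuous_plaquetteObs ρ hρ _ _ _) μ]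
  exact integral_congr_ae (ae_of_all _ fun U => integral_haar_shiftAction ρ hρ hρ0 e U)

end Fubini

end

end Summit.QuantumFields.GaugeBoot
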